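import Mathlib

/-!
# Crux `TateFamilyKernel` (stmt-KontsevichZagierPeriods-9130), line `Sketch`:
# stub `stub_gpCertificate`

Step GP4 (CERTIFICATE, pure algebra) of the graph-pencil class of the lead's skeleton of the crux
`Summit.KontsevichZagierPeriods.KontsevichZagierPeriods.Theses.InverseLandau.TateFamilyKernel`.
Variables: `X 0 = z₁`, `X 1 = z₂`, `X 2 = ϖ`; Tate denominator
`Q = 1 − ϖ·(u(z₂) + β z₁) ∈ ℚ[z₁, z₂, ϖ]` with `u ∈ ℚ[s]`, `β ∈ ℚ`.

If the `ϖ`-free numerator is in the image of the twisted divergence,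
`P = u′(z₂)·∂₀M − β·∂₁M` for a polynomial `M ∈ ℚ[z₁,z₂]`, then `P/Q` is Griffiths-exact with
denominator `Q` itself:
`P/Q = ∂₀(u′M/Q) + ∂₁(−βM/Q)`, because `∂₀Q = −ϖβ` and `∂₁Q = −ϖu′(z₂)` make the two `Q⁻²`
cross terms `±ϖβu′M/Q²` cancel. The statement is the pointwise form of this identity at a real
point `(w, ϖ)` where `Q ≠ 0`, with both quotient-rule numerators written out
(`∂ᵢ(Aᵢ/Q) = (∂ᵢAᵢ·Q − Aᵢ·∂ᵢQ)/Q²`, `A₀ = u′M`, `A₁ = −βM`, lifted to three variables by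
`rename Fin.castSucc`).

Proof: the polynomial identities `∂₀Q = −(ϖ·β)`, `∂₁Q = −(ϖ·u′(z₂))` (chain rule
`Derivation.map_aeval` for the derivation `pderiv`), `∂ᵢ ∘ rename castSucc = rename castSucc ∘ ∂ᵢ`
(`MvPolynomial.pderiv_rename`), `rename castSucc (u′(X 1)) = u′(X 1)`; after evaluating by the
algebra map `aeval (Fin.snoc w ϖ)` the claim is a field identity in eight real atoms
(`field_simp`, `ring`).

References: Kontsevich–Zagier 2001, §1.2 (an elementary algebraic step of one test class of the
period conjecture). Mathlib only; no named fact, no new definition. Helpers live in the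
sub-namespace `GpCertificate`.
-/

noncomputable section

open MvPolynomial

namespace Summit.KontsevichZagierPeriods.InverseLandau.TateFamilyKernel.Descent

namespace GpCertificate

/-! ### Chain rule for `pderiv` through a one-variable polynomial -/

/-- `∂ⱼ u(Xⱼ) = u′(Xⱼ)` for a one-variable polynomial `u` substituted at the variable `Xⱼ`
(chain rule for the derivation `pderiv j`). [folklore] -/
theorem pderiv_polyAeval_self {σ : Type*} (j : σ) (p : Polynomial ℚ) :
    pderiv j (Polynomial.aeval (X j : MvPolynomial σ ℚ) p) =
      Polynomial.aeval (X j : MvPolynomial σ ℚ) (Polynomial.derivative p) := by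
  rw [Derivation.map_aeval, pderiv_X_self, smul_eq_mul, mul_one]

/-- `∂ᵢ u(Xⱼ) = 0` for `j ≠ i`. [folklore] -/
theorem pderiv_polyAeval_of_ne {σ : Type*} {i j : σ} (h : j ≠ i) (p : Polynomial ℚ) :
    pderiv i (Polynomial.aeval (X j : MvPolynomial σ ℚ) p) = 0 := by
  rw [Derivation.map_aeval, pderiv_X_of_ne h, smul_zero]

/-! ### The partial derivatives of the Tate denominator `Q = 1 − ϖ(u(z₂) + βz₁)` -/

/-- `∂₀ Q = −ϖβ` for `Q = 1 − X₂·(u(X₁) + β X₀)`. [folklore] -/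
theorem pderiv_zero_gpQ (u : Polynomial ℚ) (β : ℚ) :
    pderiv 0 (1 - X 2 * (Polynomial.aeval (X 1 : MvPolynomial (Fin (2 + 1)) ℚ) u + C β * X 0)) =
      -(X 2 * C β) := by
  have h10 : (1 : Fin (2 + 1)) ≠ 0 := by decide
  have h20 : (2 : Fin (2 + 1)) ≠ 0 := by decide
  rw [map_sub, Derivation.map_one_eq_zero, pderiv_mul, pderiv_X_of_ne h20, map_add,
    pderiv_polyAeval_of_ne h10, pderiv_C_mul, pderiv_X_self]
  ring

/-- `∂₁ Q = −ϖ·u′(X₁)` for `Q = 1 − X₂·(u(X₁) + β X₀)`. [folklore] -/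
theorem pderiv_one_gpQ (u : Polynomial ℚ) (β : ℚ) :
    pderiv 1 (1 - X 2 * (Polynomial.aeval (X 1 : MvPolynomial (Fin (2 + 1)) ℚ) u + C β * X 0)) =
      -(X 2 * Polynomial.aeval (X 1 : MvPolynomial (Fin (2 + 1)) ℚ) (Polynomial.derivative u)) := by
  have h01 : (0 : Fin (2 + 1)) ≠ 1 := by decide
  have h21 : (2 : Fin (2 + 1)) ≠ 1 := by decide
  rw [map_sub, Derivation.map_one_eq_zero, pderiv_mul, pderiv_X_of_ne h21, map_add,
    pderiv_polyAeval_self, pderiv_C_mul, pderiv_X_of_ne h01]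
  ring

/-! ### Lifting from `ℚ[z₁,z₂]` to `ℚ[z₁,z₂,ϖ]` by `rename Fin.castSucc` -/

/-- `rename castSucc (u(X₁)) = u(X₁)` (the lift of a polynomial in `z₂` alone). [folklore] -/
theorem rename_polyAeval (p : Polynomial ℚ) :
    rename Fin.castSucc (Polynomial.aeval (X 1 : MvPolynomial (Fin 2) ℚ) p) =
      Polynomial.aeval (X 1 : MvPolynomial (Fin (2 + 1)) ℚ) p := by
  rw [← Polynomial.aeval_algHom_apply, rename_X, Fin.castSucc_one]

/-- `∂₀` commutes with the lift `rename castSucc`. [folklore] -/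
theorem pderiv_zero_rename (F : MvPolynomial (Fin 2) ℚ) :
    pderiv 0 (rename Fin.castSucc F : MvPolynomial (Fin (2 + 1)) ℚ) =
      rename Fin.castSucc (pderiv 0 F) := by
  have h := pderiv_rename (Fin.castSucc_injective 2) (0 : Fin 2) F
  rwa [Fin.castSucc_zero] at h

/-- `∂₁` commutes with the lift `rename castSucc`. [folklore] -/
theorem pderiv_one_rename (F : MvPolynomial (Fin 2) ℚ) :
    pderiv 1 (rename Fin.castSucc F : MvPolynomial (Fin (2 + 1)) ℚ) =
      rename Fin.castSucc (pderiv 1 F) := by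
  have h := pderiv_rename (Fin.castSucc_injective 2) (1 : Fin 2) F
  rwa [Fin.castSucc_one] at h

/-- `∂₀` of the lifted datum `A₀ = u′(z₂)·M`: `∂₀(u′M) = u′·∂₀M` (`u′(z₂)` is `z₁`-free).
[folklore] -/
theorem pderiv_zero_A0 (u : Polynomial ℚ) (M : MvPolynomial (Fin 2) ℚ) :
    pderiv 0 (rename Fin.castSucc
        (Polynomial.aeval (X 1 : MvPolynomial (Fin 2) ℚ) (Polynomial.derivative u) * M) :
          MvPolynomial (Fin (2 + 1)) ℚ) =
      Polynomial.aeval (X 1 : MvPolynomial (Fin (2 + 1)) ℚ) (Polynomial.derivative u) *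
        rename Fin.castSucc (pderiv 0 M) := by
  have h10 : (1 : Fin 2) ≠ 0 := by decide
  rw [pderiv_zero_rename, pderiv_mul, pderiv_polyAeval_of_ne h10, zero_mul, zero_add, map_mul,
    rename_polyAeval]

/-- The lifted datum `A₀ = u′(z₂)·M` itself. [folklore] -/
theorem rename_A0 (u : Polynomial ℚ) (M : MvPolynomial (Fin 2) ℚ) :
    (rename Fin.castSucc
        (Polynomial.aeval (X 1 : MvPolynomial (Fin 2) ℚ) (Polynomial.derivative u) * M) :
          MvPolynomial (Fin (2 + 1)) ℚ) =
      Polynomial.aeval (X 1 : MvPolynomial (Fin (2 + 1)) ℚ) (Polynomial.derivative u) *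
        rename Fin.castSucc M := by
  rw [map_mul, rename_polyAeval]

/-- `∂₁` of the lifted datum `A₁ = −βM`: `∂₁(−βM) = −β·∂₁M`. [folklore] -/
theorem pderiv_one_A1 (β : ℚ) (M : MvPolynomial (Fin 2) ℚ) :
    pderiv 1 (rename Fin.castSucc (-(C β * M)) : MvPolynomial (Fin (2 + 1)) ℚ) =
      -(C β * rename Fin.castSucc (pderiv 1 M)) := by
  rw [pderiv_one_rename, map_neg, pderiv_C_mul, map_neg, map_mul, rename_C]

/-- The lifted datum `A₁ = −βM` itself. [folklore] -/
theorem rename_A1 (β : ℚ) (M : MvPolynomial (Fin 2) ℚ) :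
    (rename Fin.castSucc (-(C β * M)) : MvPolynomial (Fin (2 + 1)) ℚ) =
      -(C β * rename Fin.castSucc M) := by
  rw [map_neg, map_mul, rename_C]

/-- The lifted numerator: `rename castSucc (u′·∂₀M − β·∂₁M) = u′(X₁)·(lift ∂₀M) − β·(lift ∂₁M)`.
[folklore] -/
theorem rename_gpP (u : Polynomial ℚ) (β : ℚ) (M : MvPolynomial (Fin 2) ℚ) :
    (rename Fin.castSucc
        (Polynomial.aeval (X 1 : MvPolynomial (Fin 2) ℚ) (Polynomial.derivative u) * pderiv 0 M -
          C β * pderiv 1 M) : MvPolynomial (Fin (2 + 1)) ℚ) =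
      Polynomial.aeval (X 1 : MvPolynomial (Fin (2 + 1)) ℚ) (Polynomial.derivative u) *
          rename Fin.castSucc (pderiv 0 M) -
        C β * rename Fin.castSucc (pderiv 1 M) := by
  rw [map_sub, map_mul, map_mul, rename_polyAeval, rename_C]

end GpCertificate

/-- STUB `stub_gpCertificate` (graph-pencil class, step GP4: CERTIFICATE, pure algebra).
`P = u′(z₂)∂₀M − β∂₁M` makes `P/Q` Griffiths-exact at family level with denominator
`Q = 1 − ϖ(u(z₂) + βz₁)` itself: `P/Q = ∂₀(u′M/Q) + ∂₁(−βM/Q)` pointwise wherever `Q ≠ 0` (the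
`Q⁻²` cross terms `±ϖβu′M` cancel since `∂₀Q = −ϖβ`, `∂₁Q = −ϖu′`), written with both quotient-rule
numerators spelled out and the data `A = (u′M, −βM)` lifted by `rename Fin.castSucc`, as consumed by
the `hexact` format of `exactFamily_mem_relations`. [cite: KontsevichZagier2001, §1.2] -/
theorem stub_gpCertificate (u : Polynomial ℚ) (β : ℚ) (P M : MvPolynomial (Fin 2) ℚ)
    (hM : P = Polynomial.aeval (X 1 : MvPolynomial (Fin 2) ℚ) (Polynomial.derivative u) * pderiv 0 M -
      C β * pderiv 1 M)
    (ϖ : ℝ) (w : Fin 2 → ℝ)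
    (hQ : aeval (Fin.snoc w ϖ : Fin (2 + 1) → ℝ)
      (1 - X 2 * (Polynomial.aeval (X 1 : MvPolynomial (Fin (2 + 1)) ℚ) u + C β * X 0)) ≠ 0) :
    aeval (Fin.snoc w ϖ : Fin (2 + 1) → ℝ) (rename Fin.castSucc P) /
        aeval (Fin.snoc w ϖ : Fin (2 + 1) → ℝ)
          (1 - X 2 * (Polynomial.aeval (X 1 : MvPolynomial (Fin (2 + 1)) ℚ) u + C β * X 0)) =
      aeval (Fin.snoc w ϖ : Fin (2 + 1) → ℝ)
          (pderiv 0 (rename Fin.castSucc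
              (Polynomial.aeval (X 1 : MvPolynomial (Fin 2) ℚ) (Polynomial.derivative u) * M)) *
              (1 - X 2 * (Polynomial.aeval (X 1 : MvPolynomial (Fin (2 + 1)) ℚ) u + C β * X 0)) -
            rename Fin.castSucc (Polynomial.aeval (X 1 : MvPolynomial (Fin 2) ℚ) (Polynomial.derivative u) * M) *
              pderiv 0 (1 - X 2 * (Polynomial.aeval (X 1 : MvPolynomial (Fin (2 + 1)) ℚ) u + C β * X 0))) /
        aeval (Fin.snoc w ϖ : Fin (2 + 1) → ℝ)
          ((1 - X 2 * (Polynomial.aeval (X 1 : MvPolynomial (Fin (2 + 1)) ℚ) u + C β * X 0)) ^ 2) +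
      aeval (Fin.snoc w ϖ : Fin (2 + 1) → ℝ)
          (pderiv 1 (rename Fin.castSucc (-(C β * M))) *
              (1 - X 2 * (Polynomial.aeval (X 1 : MvPolynomial (Fin (2 + 1)) ℚ) u + C β * X 0)) -
            rename Fin.castSucc (-(C β * M)) *
              pderiv 1 (1 - X 2 * (Polynomial.aeval (X 1 : MvPolynomial (Fin (2 + 1)) ℚ) u + C β * X 0))) /
        aeval (Fin.snoc w ϖ : Fin (2 + 1) → ℝ)
          ((1 - X 2 * (Polynomial.aeval (X 1 : MvPolynomial (Fin (2 + 1)) ℚ) u + C β * X 0)) ^ 2) := by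
  subst hM
  rw [GpCertificate.rename_gpP, GpCertificate.pderiv_zero_A0, GpCertificate.rename_A0,
    GpCertificate.pderiv_one_A1, GpCertificate.rename_A1, GpCertificate.pderiv_zero_gpQ,
    GpCertificate.pderiv_one_gpQ]
  simp only [map_sub, map_add, map_mul, map_neg, map_pow, map_one] at hQ ⊢
  field_simp
  ring

end Summit.KontsevichZagierPeriods.InverseLandau.TateFamilyKernel.Descent
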